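import Mathlib
import Summits.ValiantsHypothesis.ValiantsHypothesis.Theorems.LacunarySymmetroidMatrixDescartesLocalMultiplicityDefs

/-!
# `MatrixDescartes` (stmt-ValiantsHypothesis-18050) — the LOCAL (multiplicity) census column: floor row and arithmetic glue

HONEST FRAMING.  Helper file (`--supports stmt-ValiantsHypothesis-18050 --as helper`), companion of
`LacunarySymmetroidMatrixDescartesLocalMultiplicity.lean`, completing the support layer of the crux-idea
«local-multiplicity-law» (val-idea-4, 2026-08-27; PASS-WITH-PRICE, tier INSTRUMENT/RECORD) with its two remaining
provable-now stubs, verbatim: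

* `stub_localFloor m K : 1 ≤ m → 2 ≤ K → ¬ LocalRootLawAt m K (m · (K − 1) − 1)` — the DIAGONAL FLOOR `μ(m, K) ≥ m (K − 1)`:
  the scalar pencil `(t − 1)^{K−1} · 1_m`, written on the exponents `0, 1, …, K − 1` with letters
  `S_l = coeff_l((X − 1)^{K−1}) · 1_m`, has determinant `(t − 1)^{m (K − 1)}`.  With the ceiling
  `stub_localDescartes` this brackets the column: `m (K − 1) ≤ μ(m, K) ≤ C(m+K−1, m) − 1`.
* `stub_localKPlusLogSq_of_localParam : LocalParamLaw → LocalKPlusLogSqLaw` — arithmetic glue between the card's two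
  law CANDIDATES (both asides, never asserted): `K · m(m+1)/2 ≤ 2 ^ (4 (K + log₂² m))`.
* `localRootLawAt_mono` — rows are monotone in the bound.

Nothing here bears on `MatrixDescartes`, Conjecture B, the doors, or `VP ≠ VNP`.  Axioms: `propext`, `Classical.choice`,
`Quot.sound`.
-/

-- `Summit.ValiantsHypothesis.ValiantsHypothesis.…` repeats a component by the D-0017 layout
-- (single-conjunct summit), which the `dupNamespace` linter flags; the name is mandated.
set_option linter.dupNamespace false

namespace Summit.ValiantsHypothesis.ValiantsHypothesis.Theorems.LacunarySymmetroidMatrixDescartes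

open Polynomial Finset
open scoped BigOperators Polynomial Matrix

/-- Local rows are monotone in the bound: `μ(m,K) ≤ B ≤ B'`. [folklore] -/
theorem localRootLawAt_mono {m K B B' : ℕ} (h : B ≤ B') (hB : LocalRootLawAt m K B) :
    LocalRootLawAt m K B' :=
  fun d S hS h0 => (hB d S hS h0).trans h

namespace LocalMultiplicity

/-- Exponents `0, 1, …, K − 1` of the diagonal floor witness. -/
def dFloor (K : ℕ) : Fin K → ℕ := fun l => (l : ℕ)

/-- Letters of the diagonal floor witness: `S_l = coeff_l ((X − 1)^{K−1}) · 1_m`. -/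
noncomputable def SFloor (m K : ℕ) : Fin K → Matrix (Fin m) (Fin m) ℝ :=
  fun l => ((X - C 1) ^ (K - 1) : ℝ[X]).coeff l • (1 : Matrix (Fin m) (Fin m) ℝ)

/-- The floor letters are symmetric (scalar matrices). -/
theorem SFloor_isSymm (m K : ℕ) (l : Fin K) : (SFloor m K l).IsSymm :=
  Matrix.isSymm_one.smul _

/-- The floor pencil is the scalar pencil `(X − 1)^{K−1} · 1_m` (for `K ≥ 1`, so that all `K` coefficients of
`(X − 1)^{K−1}` are available on the exponents `0, …, K − 1`). -/
theorem pencil_floor_eq (m K : ℕ) (hK : 1 ≤ K) :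
    (∑ l : Fin K, ((X : ℝ[X]) ^ dFloor K l) • (SFloor m K l).map C)
      = Matrix.diagonal fun _ : Fin m => (X - C 1) ^ (K - 1) := by
  -- the scalar polynomial, resummed from its coefficients
  have hp : (∑ l : Fin K, (X : ℝ[X]) ^ (l : ℕ) * C (((X - C 1) ^ (K - 1) : ℝ[X]).coeff l))
      = (X - C 1) ^ (K - 1) := by
    have hdeg : ((X - C 1) ^ (K - 1) : ℝ[X]).natDegree < K := by
      rw [(monic_X_sub_C (1 : ℝ)).natDegree_pow, natDegree_X_sub_C, mul_one]
      omega
    conv_rhs => rw [((X - C 1) ^ (K - 1) : ℝ[X]).as_sum_range_C_mul_X_pow' hdeg]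
    rw [← Fin.sum_univ_eq_sum_range (fun i => C (((X - C 1) ^ (K - 1) : ℝ[X]).coeff i) * X ^ i) K]
    exact Finset.sum_congr rfl fun l _ => mul_comm _ _
  ext i j
  simp only [Matrix.sum_apply, Matrix.smul_apply, Matrix.map_apply, SFloor, dFloor, Matrix.one_apply,
    smul_eq_mul, Matrix.diagonal_apply]
  by_cases hij : i = j
  · simp only [hij, if_true, mul_one, hp]
  · simp [hij]

/-- The determinant of the floor pencil is `(X − 1)^{(K−1) m}`. -/
theorem pencilDet_floor (m K : ℕ) (hK : 1 ≤ K) :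
    pencilDet (dFloor K) (SFloor m K) = (X - C 1) ^ ((K - 1) * m) := by
  unfold pencilDet
  rw [pencil_floor_eq m K hK, Matrix.det_diagonal, Finset.prod_const, Finset.card_univ, Fintype.card_fin,
    ← pow_mul]

end LocalMultiplicity

open LocalMultiplicity in
/-- **Row `stub_localFloor` — the diagonal floor `μ(m, K) ≥ m (K − 1)`** (`m ≥ 1`, `K ≥ 2`): the local row with bound
`m (K − 1) − 1` FAILS, witnessed by the scalar pencil `(t − 1)^{K−1} · 1_m` on the exponents `0, …, K − 1`
(letters `coeff_l((X−1)^{K−1}) · 1_m`, symmetric), whose determinant `(t − 1)^{m (K−1)}` vanishes at `t = 1` to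
order exactly `m (K − 1)`.  Verbatim the sketch's `stub_localFloor`. [folklore] -/
theorem stub_localFloor (m K : ℕ) (hm : 1 ≤ m) (hK : 2 ≤ K) :
    ¬ LocalRootLawAt m K (m * (K - 1) - 1) := by
  intro h
  have hdet := pencilDet_floor m K (by omega)
  have hne : pencilDet (dFloor K) (SFloor m K) ≠ 0 := by
    rw [hdet]; exact pow_ne_zero _ (X_sub_C_ne_zero 1)
  have hle := h (dFloor K) (SFloor m K) (SFloor_isSymm m K) hne
  rw [hdet, rootMultiplicity_X_sub_C_pow, Nat.mul_comm] at hle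
  have hpos : 1 ≤ m * (K - 1) := Nat.mul_le_mul hm (by omega : 1 ≤ K - 1)
  omega

/-- **Arithmetic glue `stub_localKPlusLogSq_of_localParam`**: the parameter-count law candidate implies the local twin
of Conjecture B, with the absolute constant `C = 4`: `K · (m(m+1)/2) ≤ 2^K · (2m)² / … ≤ 2 ^ (4 (K + log₂² m))`
(`K ≤ 2^K`, `m < 2^{log₂ m + 1}`).  Both sides are the card's ASIDES; nothing is asserted about either.
Verbatim the sketch's `stub_localKPlusLogSq_of_localParam`. [folklore] -/
theorem stub_localKPlusLogSq_of_localParam : LocalParamLaw → LocalKPlusLogSqLaw := by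
  intro h
  refine ⟨4, fun m K => localRootLawAt_mono ?_ (h m K)⟩
  -- `K * (m * (m + 1) / 2) ≤ 2 ^ (4 * (K + Nat.log 2 m ^ 2))`
  rcases Nat.eq_zero_or_pos K with hK | hK
  · subst hK; simp
  set L := Nat.log 2 m with hL
  have hm1 : m ≤ 2 ^ (L + 1) := (Nat.lt_pow_succ_log_self one_lt_two m).le
  have h1 : m * (m + 1) / 2 ≤ m * m := by
    apply Nat.div_le_of_le_mul
    nlinarith
  have h2 : m * m ≤ 2 ^ (L + 1) * 2 ^ (L + 1) := Nat.mul_le_mul hm1 hm1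
  have h3 : K ≤ 2 ^ K := K.lt_two_pow_self.le
  have hLL : L ≤ L * L := by
    rcases Nat.eq_zero_or_pos L with h0 | h0
    · simp [h0]
    · exact Nat.le_mul_of_pos_left L h0
  calc K * (m * (m + 1) / 2) ≤ 2 ^ K * (2 ^ (L + 1) * 2 ^ (L + 1)) := Nat.mul_le_mul h3 (h1.trans h2)
    _ = 2 ^ (K + (L + 1) + (L + 1)) := by rw [← pow_add, ← pow_add]; ring_nf
    _ ≤ 2 ^ (4 * (K + L ^ 2)) := by
        apply Nat.pow_le_pow_right (by norm_num)
        rw [sq]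
        linarith

end Summit.ValiantsHypothesis.ValiantsHypothesis.Theorems.LacunarySymmetroidMatrixDescartes
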